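import Summits.QuantumAdvantage.QuantumAdvantage.Theorems.MobiusLadderLiouvilleOrthogonalTC0OrLtf
import Summits.QuantumAdvantage.QuantumAdvantage.Theorems.MobiusLadderLiouvilleOrthogonalTC0LtfCombination
import HarnessLib

/-!
# Crux `MobiusLadder.LiouvilleOrthogonalTC0` (stmt-QuantumAdvantage-1393): `λ` is orthogonal to every
Boolean combination of `≤ n^α` unions of polynomially many halfspaces in the binary digits

Line `Sketch`, skeleton v6 (lead `prover-line-stmt-QuantumAdvantage-1393-c4-0`). The union bound for block
sensitivity (`LtfCombination.sens_comp_le`) on top of Kane's theorem (`OrLtf.sens_orLtf_le`): for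
`F = h(P_1, …, P_s)` with `h : {0,1}^s → {0,1}` ARBITRARY and each block `P_l = [∃ a < K, L_{l,a}]` an OR
of `K` integer linear threshold tests of the digits (ANDs and single tests are special cases, negations
being absorbed into `h`), the block sensitivity along any `m`-partition is
`≤ s (4√log((K+1)(m+1)) + 8) 2ⁿ√m`, so the Fourier tail at the spectral level `⌊n^{1/R}⌋₊ + 1` is
`≪ s √(log n) n^{-1/(2R)}`, which tends to `0` as soon as `s ≤ n^α` with `α = 1/(8R)`.

* `liouville_orthogonal_orLtf_combination` — there is `α > 0` such that for every `A`, every `ε > 0`,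
  eventually in `n`: for all `s ≤ n^α`, `K ≤ n^A`, every `h : {0,1}^s → {0,1}` and all integer tests,
  `|Σ_{N<2ⁿ} λ(N) sgn h(P_1(N), …, P_s(N))| ≤ ε 2ⁿ`.

In circuit terms: `λ` is orthogonal to every depth-THREE `tcBasis` circuit whose output gate (any of
`∧/∨/MAJ`, under free negations) reads `≤ n^α` distinct wires, each an `∧/∨` gate (any polynomial
fan-in) over threshold gates of the digits or a threshold gate itself — e.g. a majority vote among
`n^α` polytopes with `poly(n)` facets each. This subsumes the rungs `LtfCombinationPoly` (`K = 1`) and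
`OrLtf` (`s = 1`).
-/

set_option linter.dupNamespace false -- D-0017: single-problem summit ⇒ `QuantumAdvantage.QuantumAdvantage` by design

noncomputable section

namespace Summit.QuantumAdvantage.QuantumAdvantage.Theorems.LiouvilleOrthogonalTC0

open Filter Finset Topology
open Literature.Computability.Complexity
open Literature.Computability.Complexity.LowDegree (tailWeight tailWeight_le_one)
open Literature.Probability.RandomGraphs.LowDegree (sgn)
open Literature.NumberTheory.Sieve

namespace OrLtfCombination

variable {n m s K : ℕ}

/-- **Block sensitivity of a Boolean combination of `s` ORs of `K` integer threshold tests** along any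
partition into `m ≥ 1` blocks: `≤ s (4√log((K+1)(m+1)) + 8) · 2ⁿ √m` (union bound + Kane). -/
theorem sens_le (hm : 1 ≤ m) (h : (Fin s → Bool) → Bool) (w : Fin s → Fin K → Fin n → ℤ)
    (t : Fin s → Fin K → ℤ) (π : Fin n → Fin m) :
    ∑ x : Fin n → Bool, ((univ.filter fun j : Fin m =>
        h (fun l => decide (∃ a : Fin K, t l a ≤ ∑ i, w l a i * (if x i then (1 : ℤ) else 0))) ≠
          h (fun l => decide (∃ a : Fin K, t l a ≤ ∑ i, w l a i *
            (if xor (x i) (decide (π i = j)) then (1 : ℤ) else 0)))).card : ℝ)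
      ≤ s * ((4 * Real.sqrt (Real.log ((K + 1) * (m + 1))) + 8) * (2 ^ n * Real.sqrt m)) := by
  have h1 := LtfCombination.sens_comp_le h
    (fun l y => decide (∃ a : Fin K, t l a ≤ ∑ i, w l a i * (if y i then (1 : ℤ) else 0))) π
  refine h1.trans ?_
  calc ∑ l : Fin s, ∑ x : Fin n → Bool, ((univ.filter fun j : Fin m =>
          decide (∃ a : Fin K, t l a ≤ ∑ i, w l a i * (if x i then (1 : ℤ) else 0)) ≠
            decide (∃ a : Fin K, t l a ≤ ∑ i, w l a i *
              (if xor (x i) (decide (π i = j)) then (1 : ℤ) else 0))).card : ℝ)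
      ≤ ∑ _l : Fin s, (4 * Real.sqrt (Real.log ((K + 1) * (m + 1))) + 8) * (2 ^ n * Real.sqrt m) := by
        refine Finset.sum_le_sum fun l _ => ?_
        have h2 := OrLtf.sens_orLtf_le hm false (w l) (t l) π
        simpa only [Bool.false_xor] using h2
    _ = s * ((4 * Real.sqrt (Real.log ((K + 1) * (m + 1))) + 8) * (2 ^ n * Real.sqrt m)) := by
        rw [Finset.sum_const, Finset.card_univ, Fintype.card_fin, nsmul_eq_mul]

/-- **Fourier tail**: `W^{≥ m}[sgn ∘ h ∘ (P_1,…,P_s)] ≤ 3 s (4√log((K+1)(m+1)) + 8)/√m` for `m ≥ 10`. -/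
theorem tailWeight_le (hm : 10 ≤ m) (h : (Fin s → Bool) → Bool) (w : Fin s → Fin K → Fin n → ℤ)
    (t : Fin s → Fin K → ℤ) :
    tailWeight (fun x : Fin n → Bool =>
        sgn (h (fun l => decide (∃ a : Fin K, t l a ≤ ∑ i, w l a i * (if x i then (1 : ℤ) else 0))))) m
      ≤ 3 * (s * (4 * Real.sqrt (Real.log ((K + 1) * (m + 1))) + 8)) / Real.sqrt m := by
  have h2 := stub_tailOfSens hm (B := s * (4 * Real.sqrt (Real.log ((K + 1) * (m + 1))) + 8))
    (fun x : Fin n → Bool =>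
      h (fun l => decide (∃ a : Fin K, t l a ≤ ∑ i, w l a i * (if x i then (1 : ℤ) else 0))))
    (fun π => by
      have := sens_le (by omega) h w t π
      linarith [this])
  exact h2

end OrLtfCombination

open OrLtfCombination in
/-- **`λ` is orthogonal to every Boolean combination of `≤ n^α` ORs of polynomially many linear threshold
tests of the binary digits** (unconditional): there is `α > 0` such that for every exponent `A` and every
`ε > 0`, for all sufficiently large `n`, for all `s ≤ n^α`, `K ≤ n^A`, every `h : {0,1}^s → {0,1}` and
all integer tests `L_{l,a}(N) = [t_{l,a} ≤ Σ_i w_{l,a,i} bit_i(N)]`,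
`|Σ_{N<2ⁿ} λ(N) · sgn h([∃ a, L_{1,a}(N)], …, [∃ a, L_{s,a}(N)])| ≤ ε · 2ⁿ`. -/
theorem liouville_orthogonal_orLtf_combination : ∃ α : ℝ, 0 < α ∧ ∀ A : ℕ, ∀ ε : ℝ, 0 < ε →
    ∀ᶠ n : ℕ in atTop, ∀ s : ℕ, (s : ℝ) ≤ (n : ℝ) ^ α → ∀ K : ℕ, K ≤ n ^ A →
      ∀ (h : (Fin s → Bool) → Bool) (w : Fin s → Fin K → Fin n → ℤ) (t : Fin s → Fin K → ℤ),
        |∑ N ∈ Finset.range (2 ^ n), ((ArithmeticFunction.liouville N : ℤ) : ℝ) *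
            sgn (h (fun l => decide (∃ a : Fin K,
              t l a ≤ ∑ i, w l a i * (if Nat.testBit N i then (1 : ℤ) else 0))))| ≤ ε * (2 : ℝ) ^ n := by
  obtain ⟨c, hc, hB⟩ := bourgain_liouville_walsh_holds
  set R : ℕ := ⌈(3 : ℝ) / c⌉₊ with hRdef
  have hR1 : 1 ≤ R := by
    have : (0 : ℝ) < 3 / c := by positivity
    exact Nat.one_le_iff_ne_zero.mpr (Nat.pos_iff_ne_zero.mp (Nat.ceil_pos.mpr this))
  have hRc : 3 ≤ (R : ℝ) * c := by
    have h1 : (3 : ℝ) / c ≤ R := Nat.le_ceil _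
    have := mul_le_mul_of_nonneg_right h1 hc.le
    rwa [div_mul_cancel₀ _ hc.ne'] at this
  have hRpos : (0 : ℝ) < R := by exact_mod_cast (show 0 < R by omega)
  set δ : ℝ := 1 / (2 * R) with hδdef
  have hδ : 0 < δ := by positivity
  have h2δ : 2 * δ = 1 / R := by rw [hδdef]; field_simp
  -- `α = δ/4`
  refine ⟨δ / 4, by positivity, fun A ε hε => ?_⟩
  have hε3 : 0 < (ε / 3) ^ 2 := by positivity
  have hdec : Tendsto (fun n : ℕ => (12 * Real.sqrt ((A + 3) / δ) + 24) * (n : ℝ) ^ (-(δ / 4)))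
      atTop (𝓝 0) := by
    have h1 : Tendsto (fun n : ℕ => (n : ℝ) ^ (-(δ / 4))) atTop (𝓝 0) :=
      (tendsto_rpow_neg_atTop (by positivity)).comp tendsto_natCast_atTop_atTop
    simpa using h1.const_mul (12 * Real.sqrt ((A + 3) / δ) + 24)
  have hlev9 : ∀ᶠ n : ℕ in atTop, 9 ≤ ⌊((n : ℝ)) ^ ((1 : ℝ) / R)⌋₊ :=
    (LtfCore.tendsto_floor_rpow hR1).eventually (eventually_ge_atTop 9)
  filter_upwards [liouville_orthogonal_of_tailWeight_level hc hB hR1 hRc ε hε,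
    hdec.eventually_le_const hε3, hlev9, eventually_ge_atTop 2]
    with n hn hsmall h9 hn2 s hs K hK h w t
  refine hn (fun y => h (fun l => decide (∃ a : Fin K,
    t l a ≤ ∑ i, w l a i * (if y i then (1 : ℤ) else 0)))) ?_
  set kk : ℕ := ⌊((n : ℝ)) ^ ((1 : ℝ) / R)⌋₊ with hkkdef
  have htail := tailWeight_le (m := kk + 1) (by omega) h w t
  refine htail.trans (le_trans ?_ hsmall)
  have hnpos : (0 : ℝ) < n := by exact_mod_cast (show 0 < n by omega)
  have hkn : kk ≤ n := by
    have hh := LtfCore.floor_rpow_pow_le hR1 n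
    calc kk = kk ^ 1 := (pow_one _).symm
      _ ≤ kk ^ R := Nat.pow_le_pow_right (by omega) hR1
      _ ≤ n := hh
  have hlev : (n : ℝ) ^ (2 * δ) < (kk : ℝ) + 1 := by
    rw [h2δ]; exact Nat.lt_floor_add_one _
  have hone := OrLtf.tail_bound_le (A := A) hδ hn2 hK hkn hlev
  have hs0 : (0 : ℝ) ≤ s := Nat.cast_nonneg s
  have hsq : (0 : ℝ) < Real.sqrt ((((kk + 1 : ℕ) : ℝ))) := Real.sqrt_pos.2 (by positivity)
  -- `3 s B / √(kk+1) = s · (3B/√(kk+1)) ≤ n^{δ/4} (12√… n^{-δ/2} + 24 n^{-δ}) ≤ (12√… + 24) n^{-δ/4}`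
  have hcast : ((K : ℝ) + 1) * ((kk + 1 : ℕ) + 1 : ℝ) = (K + 1) * ((((kk + 1 : ℕ) : ℝ)) + 1) := by
    push_cast; ring
  calc 3 * (s * (4 * Real.sqrt (Real.log ((K + 1) * ((((kk + 1 : ℕ) : ℝ)) + 1))) + 8)) /
        Real.sqrt ((((kk + 1 : ℕ) : ℝ)))
      = s * (3 * (4 * Real.sqrt (Real.log ((K + 1) * ((((kk + 1 : ℕ) : ℝ)) + 1))) + 8) /
          Real.sqrt ((((kk + 1 : ℕ) : ℝ)))) := by ring
    _ ≤ (n : ℝ) ^ (δ / 4) * (12 * Real.sqrt ((A + 3) / δ) * (n : ℝ) ^ (-(δ / 2)) + 24 * (n : ℝ) ^ (-δ)) :=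
        mul_le_mul hs hone (by positivity) (by positivity)
    _ ≤ (12 * Real.sqrt ((A + 3) / δ) + 24) * (n : ℝ) ^ (-(δ / 4)) := by
        have hn1 : (1 : ℝ) ≤ n := by exact_mod_cast (show 1 ≤ n by omega)
        have e1 : (n : ℝ) ^ (δ / 4) * (n : ℝ) ^ (-(δ / 2)) = (n : ℝ) ^ (-(δ / 4)) := by
          rw [← Real.rpow_add hnpos]; congr 1; ring
        have e2 : (n : ℝ) ^ (δ / 4) * (n : ℝ) ^ (-δ) ≤ (n : ℝ) ^ (-(δ / 4)) := by
          rw [← Real.rpow_add hnpos]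
          exact Real.rpow_le_rpow_of_exponent_le hn1 (by linarith)
        have hsq0 : (0 : ℝ) ≤ 12 * Real.sqrt ((A + 3) / δ) := by positivity
        calc (n : ℝ) ^ (δ / 4) * (12 * Real.sqrt ((A + 3) / δ) * (n : ℝ) ^ (-(δ / 2)) + 24 * (n : ℝ) ^ (-δ))
            = 12 * Real.sqrt ((A + 3) / δ) * ((n : ℝ) ^ (δ / 4) * (n : ℝ) ^ (-(δ / 2))) +
                24 * ((n : ℝ) ^ (δ / 4) * (n : ℝ) ^ (-δ)) := by ring
          _ ≤ 12 * Real.sqrt ((A + 3) / δ) * (n : ℝ) ^ (-(δ / 4)) + 24 * (n : ℝ) ^ (-(δ / 4)) := by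
              rw [e1]
              exact add_le_add le_rfl (mul_le_mul_of_nonneg_left e2 (by norm_num))
          _ = (12 * Real.sqrt ((A + 3) / δ) + 24) * (n : ℝ) ^ (-(δ / 4)) := by ring

end Summit.QuantumAdvantage.QuantumAdvantage.Theorems.LiouvilleOrthogonalTC0

end

namespace Summit.QuantumAdvantage.QuantumAdvantage.Theorems.LiouvilleOrthogonalTC0

open Filter Finset
open Literature.Probability.RandomGraphs.LowDegree (sgn)

/-- **Registered stub `stub_orLtfCombination`** (line `Sketch`, v6, lead c4): verbatim
`liouville_orthogonal_orLtf_combination`. -/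
theorem stub_orLtfCombination : ∃ α : ℝ, 0 < α ∧ ∀ A : ℕ, ∀ ε : ℝ, 0 < ε → ∀ᶠ n : ℕ in atTop, ∀ s : ℕ, (s : ℝ) ≤ (n : ℝ) ^ α → ∀ K : ℕ, K ≤ n ^ A → ∀ (h : (Fin s → Bool) → Bool) (w : Fin s → Fin K → Fin n → ℤ) (t : Fin s → Fin K → ℤ), |∑ N ∈ Finset.range (2 ^ n), ((ArithmeticFunction.liouville N : ℤ) : ℝ) * sgn (h (fun l => decide (∃ a : Fin K, t l a ≤ ∑ i, w l a i * (if Nat.testBit N i then (1 : ℤ) else 0))))| ≤ ε * (2 : ℝ) ^ n :=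
  liouville_orthogonal_orLtf_combination

end Summit.QuantumAdvantage.QuantumAdvantage.Theorems.LiouvilleOrthogonalTC0
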